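import Summits.QuantumFields.BalabanUV.T4Continuum.Support.B13StepEndLoc
import Summits.QuantumFields.BalabanUV.T4Continuum.Support.B13StepEndArithmeticWindow

/-!
# NE5 ∕ U3 — THE R21 (2.14)-FACE ON THE R20 SUB-SLOT WITH THE ARITHMETIC LETTERS ELIMINATED: per pair of runs (`∃ C₅`), η-UNIFORM
# (`∃ C₅, ∀ R S₀ M …`) and WINDOWWISE with a g-INDEXED (2.14) DICTIONARY (R24 × R29′) — row O6-n follower of leaf-09-g2's `B13StepEndLoc`
# (p217399: the owner's `ne5_at_of_stepModel_termwiseLoc_gaussianParamBi_mass_scale_nat` applied BY NAME on the record sub-slot)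

Cell `pub-balaban`, unit `b2b-balaban-t4-ne5-formalise-leaf-10` (NE5 formalisation swarm, LEAF PROVER 10, gen 5; journal OFFER `CLAIMS.log`
l.12169 taken up by the END author leaf-09-g2 l.12459∕l.12620, INTENT l.12672∕its successor line; CLAIM RULE 1 — the N69 pattern).
Summits-side new work under the LEAN PLACEMENT RULE (cell bookkeeping; NOT a Literature module; 0 `def`, 0 cite tag); nothing landed is
edited.  HONEST FRAMING: rung (B)+1 of the FINITE-VOLUME T⁴ continuum programme — NOT infinite volume, NOT a mass gap, NOT the Clay problem,
and **NOT A PROOF OF NE5** (NOT PRINTED; GAPS G-t4-U3-1): every theorem is an IMPLICATION whose wall binders — the ONE (2.14) SHAPE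
`TermGaussianParamBi` of the restricted term family about the self-centred centre with its per-domain mass letters `hmass` and budget
`TermBudgetLoc a G` (W2 = (H-rep) + margin∕growth∕weight letters, GAPS G-ne5p1-1′, NOT PRINTED; [Balaban1988RG2Cluster] (2.14)–(2.18)
pp. 15–16 and (2.41) p. 21 are locators of KIND only), W1 in row NE2's entry currency, W3 slice budgets, W4, the quoted levels L05∕L06
([Balaban1987RG1] (1.18) p. 263 — SHAPE only), rooms — are DISPLAYED HYPOTHESES, asserted nowhere.  HONEST DEPENDENCY (cell line,
verbatim): continuum YM on T⁴ ⇐ BetaPertH ∧ nine spine estimates (0/9 proved); BetaPertH ⇐ (D1) ∧ (D4) ∧ CAP+tail; G-an2-4 gates asym, D1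
and NE2/3/4.

WHAT THIS FILE DOES (compositions BY NAME; no estimate of its own) — for leaf-09's `B13StepEndLoc.ne5_of_record_restrict_gaussianParamBi_mass`
(root LITERALLY `NE5 (B13StepOfRecord.outA S₀ E₀ cB) (B13StepOfRecord.outB S₀ E₀ cB) …`; operator ball of the shape's clauses in `↥M`):
* §1 **`exists_ne5_of_record_restrict_gaussianParamBi_mass`** — the five arithmetic binders over `ρ₀, k₀, B` REPLACED by `0 < θ < 1` and the two
  strict size inequalities `cA(EA₀ + E₀) < 1 − ω`, `ω + G·cA·(1 − ω)∕(1 − ω − cA(EA₀ + E₀)) < θ′` (`reach_elim_iff` ∕ `reach_binders_exists` ∕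
  `smallness_of_gain`, `E₁ := 1`); `∃ C₅` per instance (R29′: terminal for its window without a displayed bound).
* §2 **`uniform_ne5_of_record_restrict_gaussianParamBi_mass`** — `∃ C₅` OUTERMOST: ONE constant from the SIZES for every pair of runs, slot
  package (`S₀.D.ω = ω`), sub-slot `M ∋` the data of record (of record `measOp`), parameter types `β`∕`α`, (2.14) dictionary
  `lam, w, N, F₀, Λ, q, m, b, w₀, N₀, F, N₁`, mass weights `a`, radii `ROp < R′`, `RHist`, and window.
* §3 **`uniform_ne5_of_record_restrict_gaussianParamBi_mass_singleton`** — §2 read WINDOWWISE (owner R24: the g-dependent non-data factors —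
  the small-field thresholds `p(g_k)` inside χ — live in a g-INDEXED dictionary on the singleton window `{g}`; R29′ (a): same `C₅`):
  every window-dependent binder at `{g}`, the dictionary `lam g, w g, N g, F₀ g, Λ g, q g, m g, b g, w₀ g, N₀ g, F g, N₁ g` and the mass
  weights `a g` g-INDEXED with the COMMON budget `G` ⟹ `NE5 (B13StepOfRecord.outA S₀ E₀ cB) (B13StepOfRecord.outB S₀ E₀ cB) W κ θ′ C₅`.
  This is the face into which leaf-08's (2.14) factor-core dictionary (R18∕R28, /7–/9) plugs per coupling with ONE constant.
The `onSub` variants (cores typed on `↥M`) are the same one-liners on `ne5_of_record_onSub_gaussianParamBi_mass` — on request.  0 sorry;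
axioms ⊆ {propext, Classical.choice, Quot.sound}.
-/

noncomputable section

open Metric Set MeasureTheory

namespace Summit.QuantumFields.BalabanUV.T4Continuum.B13StepEndLocArithmetic

open Literature.MathematicalPhysics.QuantumFieldTheory.Balaban1983to89
open Literature.MathematicalPhysics.QuantumFieldTheory.Balaban1983to89.T4OutputRate (Carriers Functional DecayBound NE5)
open Literature.MathematicalPhysics.QuantumFieldTheory.Balaban1983to89.T4InputCauchyRateSpecies (ballClass)
open Summit.QuantumFields.BalabanUV.T4Continuum.B13Carriers (TwoRuns)
open Summit.QuantumFields.BalabanUV.T4Continuum.B13OpDatum (OpDatum)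
open Summit.QuantumFields.BalabanUV.T4Continuum.B13OpDatumJunctions (opOf RawBounded WeightedEntrywiseRate)
open Summit.QuantumFields.BalabanUV.T4Continuum.B13StepTermLabels (TermIdx InnerLabel)
open Summit.QuantumFields.BalabanUV.T4Continuum.B13StepTermFamily (term)
open Summit.QuantumFields.BalabanUV.T4Continuum.B13InnerData (Bnd)
open Summit.QuantumFields.BalabanUV.T4Continuum.B13Base (selfCtr)
open Summit.QuantumFields.BalabanUV.T4Continuum.B13StepOfRecord (Slots assembly step)
open Summit.QuantumFields.BalabanUV.T4Continuum.B13StepOfRecordSub (assemblyOn restrict)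
open Summit.QuantumFields.BalabanUV.T4Continuum.OutputRateOpGaussianParam (paramMass)
open Summit.QuantumFields.BalabanUV.T4Continuum.OutputRateGaussianParamBi (TermGaussianParamBi)
open Summit.QuantumFields.BalabanUV.T4Continuum.OutputRateTermwiseLoc (TermBudgetLoc)
open Summit.QuantumFields.BalabanUV.T4Continuum.B13StepEndLoc (ne5_of_record_restrict_gaussianParamBi_mass)
open Summit.QuantumFields.BalabanUV.T4Continuum.B13StepEndArithmetic (reach_elim_iff smallness_of_gain)
open Summit.QuantumFields.BalabanUV.T4Continuum.OutputRateArithmetic (reach_binders_exists)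
open Summit.QuantumFields.BalabanUV.T4Continuum.OutputRateWindow (ne5_of_forall_singleton)

/-! ## §1 Per pair of runs: the letters `ρ₀`, `k₀`, `B` eliminated -/

section PerInstance

variable {𝔾 : Type} [GaugeGroup 𝔾] {R : TwoRuns 𝔾} {E IOp Hist : Type*} [NormedAddCommGroup Hist] [NormedSpace ℂ Hist]
  (S₀ : Slots R E IOp Hist) (M : Submodule ℂ (OpDatum E))
  (hMA : ∀ g V k, opOf S₀.F S₀.rawA g V k ∈ M) (hMB : ∀ g U k, opOf S₀.F S₀.rawB g U k ∈ M) (E₀ cB : ℝ)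
  {β : ℕ → TermIdx R.carriers.Dom (Bnd R) → Type*} [∀ k i, MeasurableSpace (β k i)]
  (α : ℕ → TermIdx R.carriers.Dom (Bnd R) → Type*) [∀ k i, NormedAddCommGroup (α k i)] [∀ k i, InnerProductSpace ℝ (α k i)]
  [∀ k i, FiniteDimensional ℝ (α k i)] [∀ k i, MeasurableSpace (α k i)] [∀ k i, BorelSpace (α k i)]

/-- [folklore] **THE (2.14)-FACE ON THE RESTRICTED SLOTS OF RECORD, ARITHMETIC LETTERS ELIMINATED** — leaf-09's
`B13StepEndLoc.ne5_of_record_restrict_gaussianParamBi_mass` with `hρ₀`∕`hnear`∕`hB`∕`hfirst`∕`hsmall` over `ρ₀, k₀, B` REPLACED by `0 < θ < 1`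
and the two strict size inequalities; every other binder BY NAME and unchanged (reading, slice budgets, levels of `B13StepOfRecord.outA∕outB`, W1
entry data + floor, W4, `TermBudgetLoc a G`, rooms `rOp ≤ ROp < R′` ∕ `bHist + rHist ≤ RHist`, the ONE shape `hBi` on the sub-slot class and the
per-domain mass letters `hmass`).  `∃ C₅, NE5 (B13StepOfRecord.outA S₀ E₀ cB) (B13StepOfRecord.outB S₀ E₀ cB) W κ θ′ C₅`. -/
theorem exists_ne5_of_record_restrict_gaussianParamBi_mass {W : Set (ℕ → ℝ)} {ROp RHist R' : ℕ → ℝ}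
    {a : ℕ → TermIdx R.carriers.Dom (Bnd R) → R.carriers.Dom → ℝ}
    {lam : ∀ k i, R.carriers.Dom → Measure (β k i)} {w : ∀ k i, R.carriers.Dom → β k i → ℂ}
    {N : ∀ k i, R.carriers.Dom → M → β k i → ℂ} {F₀ : ∀ k i, R.carriers.Dom → β k i → α k i → ℂ}
    {Λ : ∀ k i, R.carriers.Dom → β k i → α k i → (Hist →L[ℂ] ℂ)} {q : ∀ k i, R.carriers.Dom → M → β k i → α k i → ℂ}
    {m b w₀ N₀ F N₁ : ℕ → TermIdx R.carriers.Dom (Bnd R) → R.carriers.Dom → ℝ}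
    {κ G EA₀ cA c₁ r₀ δ' θ θ' : ℝ}
    (hT : (assembly S₀).TransportReads W)
    (hbB : (assembly S₀).SliceBudgetB W κ cB) (hbA : S₀.D.SliceBudget (step S₀ E₀ cB) W κ cA)
    (hdA : DecayBound (B13StepOfRecord.outA S₀ E₀ cB) W EA₀ κ) (hdB : DecayBound (B13StepOfRecord.outB S₀ E₀ cB) W E₀ κ)
    (hRA : RawBounded S₀.F (assembly S₀).rawAt W) (hRB : RawBounded S₀.F S₀.rawB W)
    (hwer : WeightedEntrywiseRate S₀.F (assembly S₀).rawAt S₀.rawB W c₁ fun k => θ ^ k) (hfl : ∀ k, r₀ ≤ S₀.rOp k)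
    (hins : (step S₀ E₀ cB).InsertionRate W κ E₀ δ' θ)
    (hbud : TermBudgetLoc a G) (hOp : ∀ k, S₀.rOp k ≤ ROp k) (hroom : ∀ k, ROp k < R' k)
    (hHist : ∀ k, (assembly S₀).bHist E₀ cB k + S₀.rHist k ≤ RHist k)
    (hBi : TermGaussianParamBi (term (assemblyOn (restrict S₀ M hMA hMB)).𝒯 (assemblyOn (restrict S₀ M hMA hMB)).inc
      (restrict S₀ M hMA hMB).act) W (selfCtr (assemblyOn (restrict S₀ M hMA hMB)).raw (assemblyOn (restrict S₀ M hMA hMB)).histRef)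
      RHist R' lam w N F₀ Λ q m b w₀ N₀ F N₁)
    (hmass : ∀ k, ∀ g ∈ W, ∀ (U : R.carriers.BgB), ∀ h ∈ closedBall
      (selfCtr (assemblyOn (restrict S₀ M hMA hMB)).raw (assemblyOn (restrict S₀ M hMA hMB)).histRef k g U).2 (RHist k),
      ∀ X : R.carriers.Dom, R.carriers.scale X = k → ∀ i,
      paramMass α (fun k i (_ : Hist) X => lam k i X) (fun k i (_ : Hist) X => m k i X) (fun k i (_ : Hist) X => b k i X)
        (fun k i (_ : Hist) X => w₀ k i X) (fun k i (_ : Hist) X => N₀ k i X)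
        (fun k i h X => F k i X * Real.exp (N₁ k i X * ‖h‖)) k i h X ≤ a k i X * Real.exp (-(κ * R.carriers.d X)))
    (hE₀ : 0 ≤ E₀) (hG : 0 ≤ G) (hcA : 0 ≤ cA) (hcB : 0 ≤ cB) (hc₁ : 0 ≤ c₁) (hr₀ : 0 < r₀) (hδ' : 0 ≤ δ')
    (hθ0 : 0 < θ) (hθ1 : θ < 1) (hθθ' : θ ≤ θ') (hθ'1 : θ' ≤ 1) (hω : 0 < S₀.D.ω) (hω1 : S₀.D.ω < 1)
    (hh : cA * (EA₀ + E₀) < 1 - S₀.D.ω)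
    (hsmall : S₀.D.ω + G * cA * (1 - S₀.D.ω) / (1 - S₀.D.ω - cA * (EA₀ + E₀)) < θ') :
    ∃ C₅, NE5 (B13StepOfRecord.outA S₀ E₀ cB) (B13StepOfRecord.outB S₀ E₀ cB) W κ θ' C₅ := by
  obtain ⟨ρ₀, hreach, hρ₀, hs⟩ := (reach_elim_iff (mul_nonneg hG hcA) hω1).mpr ⟨hh, hsmall⟩
  obtain ⟨k₀, B, hB, hnear, hfirst⟩ :=
    reach_binders_exists (D := c₁ / r₀ + δ') (add_nonneg (div_nonneg hc₁ hr₀.le) hδ') hθ0 hθ1 hreach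
  exact ⟨_, ne5_of_record_restrict_gaussianParamBi_mass S₀ M hMA hMB E₀ cB α hT hbB hbA hdA hdB hRA hRB hwer hfl hins hbud hOp hroom hHist
    hBi hmass hE₀ one_pos hG hcA hcB hc₁ hr₀ hδ' hθ0.le hθθ' hθ'1 hω hω1 hρ₀ hnear hB hfirst (smallness_of_gain hs)⟩

end PerInstance

/-! ## §2 η-uniform: ONE constant for every pair of runs, slot package, sub-slot, dictionary and window -/

section Uniform

/-- [folklore] **THE (2.14)-FACE ON THE RESTRICTED SLOTS OF RECORD WITH A CONSTANT UNIFORM IN THE PAIR OF RUNS, THE SUB-SLOT AND THE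
DICTIONARY.**  Fix the SIZES `κ, G, EA₀, E₀, cA, cB, c₁, r₀, δ′`, `0 < θ < 1`, `θ ≤ θ′ ≤ 1`, `0 < ω < 1` subject to `cA(EA₀ + E₀) < 1 − ω` and
`ω + G·cA·(1 − ω)∕(1 − ω − cA(EA₀ + E₀)) < θ′`.  Then ONE `C₅` serves EVERY pair of runs `R`, slot package `S₀` (`S₀.D.ω = ω`), sub-slot `M ∋`
the data of record, parameter types `β`∕`α`, (2.14) dictionary `lam … N₁`, mass weights `a`, radii and window: the displayed binders of
`B13StepEndLoc.ne5_of_record_restrict_gaussianParamBi_mass` imply `NE5 (B13StepOfRecord.outA S₀ E₀ cB) (B13StepOfRecord.outB S₀ E₀ cB) W κ θ′ C₅`.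
The η-uniformity is the quantifier order `∃ C₅, ∀ …`.  NOT a proof of NE5: an implication from displayed binders. -/
theorem uniform_ne5_of_record_restrict_gaussianParamBi_mass {κ G EA₀ E₀ cA cB c₁ r₀ δ' θ θ' ω : ℝ}
    (hE₀ : 0 ≤ E₀) (hG : 0 ≤ G) (hcA : 0 ≤ cA) (hcB : 0 ≤ cB) (hc₁ : 0 ≤ c₁) (hr₀ : 0 < r₀) (hδ' : 0 ≤ δ')
    (hθ0 : 0 < θ) (hθ1 : θ < 1) (hθθ' : θ ≤ θ') (hθ'1 : θ' ≤ 1) (hω : 0 < ω) (hω1 : ω < 1)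
    (hh : cA * (EA₀ + E₀) < 1 - ω) (hsmall : ω + G * cA * (1 - ω) / (1 - ω - cA * (EA₀ + E₀)) < θ') :
    ∃ C₅ : ℝ, ∀ {𝔾 : Type} [GaugeGroup 𝔾] {R : TwoRuns 𝔾} {E IOp Hist : Type*} [NormedAddCommGroup Hist] [NormedSpace ℂ Hist]
      (S₀ : Slots R E IOp Hist) (M : Submodule ℂ (OpDatum E))
      (hMA : ∀ g V k, opOf S₀.F S₀.rawA g V k ∈ M) (hMB : ∀ g U k, opOf S₀.F S₀.rawB g U k ∈ M)
      {β : ℕ → TermIdx R.carriers.Dom (Bnd R) → Type*} [∀ k i, MeasurableSpace (β k i)]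
      (α : ℕ → TermIdx R.carriers.Dom (Bnd R) → Type*) [∀ k i, NormedAddCommGroup (α k i)] [∀ k i, InnerProductSpace ℝ (α k i)]
      [∀ k i, FiniteDimensional ℝ (α k i)] [∀ k i, MeasurableSpace (α k i)] [∀ k i, BorelSpace (α k i)]
      {W : Set (ℕ → ℝ)} {ROp RHist R' : ℕ → ℝ} {a : ℕ → TermIdx R.carriers.Dom (Bnd R) → R.carriers.Dom → ℝ}
      {lam : ∀ k i, R.carriers.Dom → Measure (β k i)} {w : ∀ k i, R.carriers.Dom → β k i → ℂ}
      {N : ∀ k i, R.carriers.Dom → M → β k i → ℂ} {F₀ : ∀ k i, R.carriers.Dom → β k i → α k i → ℂ}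
      {Λ : ∀ k i, R.carriers.Dom → β k i → α k i → (Hist →L[ℂ] ℂ)} {q : ∀ k i, R.carriers.Dom → M → β k i → α k i → ℂ}
      {m b w₀ N₀ F N₁ : ℕ → TermIdx R.carriers.Dom (Bnd R) → R.carriers.Dom → ℝ},
      S₀.D.ω = ω →
      (assembly S₀).TransportReads W →
      (assembly S₀).SliceBudgetB W κ cB → S₀.D.SliceBudget (step S₀ E₀ cB) W κ cA →
      DecayBound (B13StepOfRecord.outA S₀ E₀ cB) W EA₀ κ → DecayBound (B13StepOfRecord.outB S₀ E₀ cB) W E₀ κ →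
      RawBounded S₀.F (assembly S₀).rawAt W → RawBounded S₀.F S₀.rawB W →
      WeightedEntrywiseRate S₀.F (assembly S₀).rawAt S₀.rawB W c₁ (fun k => θ ^ k) → (∀ k, r₀ ≤ S₀.rOp k) →
      (step S₀ E₀ cB).InsertionRate W κ E₀ δ' θ →
      TermBudgetLoc a G → (∀ k, S₀.rOp k ≤ ROp k) → (∀ k, ROp k < R' k) →
      (∀ k, (assembly S₀).bHist E₀ cB k + S₀.rHist k ≤ RHist k) →
      TermGaussianParamBi (term (assemblyOn (restrict S₀ M hMA hMB)).𝒯 (assemblyOn (restrict S₀ M hMA hMB)).inc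
        (restrict S₀ M hMA hMB).act) W (selfCtr (assemblyOn (restrict S₀ M hMA hMB)).raw (assemblyOn (restrict S₀ M hMA hMB)).histRef)
        RHist R' lam w N F₀ Λ q m b w₀ N₀ F N₁ →
      (∀ k, ∀ g ∈ W, ∀ (U : R.carriers.BgB), ∀ h ∈ closedBall
        (selfCtr (assemblyOn (restrict S₀ M hMA hMB)).raw (assemblyOn (restrict S₀ M hMA hMB)).histRef k g U).2 (RHist k),
        ∀ X : R.carriers.Dom, R.carriers.scale X = k → ∀ i,
        paramMass α (fun k i (_ : Hist) X => lam k i X) (fun k i (_ : Hist) X => m k i X) (fun k i (_ : Hist) X => b k i X)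
          (fun k i (_ : Hist) X => w₀ k i X) (fun k i (_ : Hist) X => N₀ k i X)
          (fun k i h X => F k i X * Real.exp (N₁ k i X * ‖h‖)) k i h X ≤ a k i X * Real.exp (-(κ * R.carriers.d X))) →
      NE5 (B13StepOfRecord.outA S₀ E₀ cB) (B13StepOfRecord.outB S₀ E₀ cB) W κ θ' C₅ := by
  obtain ⟨ρ₀, hreach, hρ₀, hs⟩ := (reach_elim_iff (mul_nonneg hG hcA) hω1).mpr ⟨hh, hsmall⟩
  obtain ⟨k₀, B, hB, hnear, hfirst⟩ :=
    reach_binders_exists (D := c₁ / r₀ + δ') (add_nonneg (div_nonneg hc₁ hr₀.le) hδ') hθ0 hθ1 hreach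
  refine ⟨(G / (1 - ρ₀) * (c₁ / r₀) + G / (1 - ρ₀) * δ' + B) * (θ' - ω) / (θ' - (ω + G / (1 - ρ₀) * cA)), ?_⟩
  intro 𝔾 _ R E IOp Hist _ _ S₀ M hMA hMB β _ α _ _ _ _ _ W ROp RHist R' a lam w N F₀ Λ q m b w₀ N₀ F N₁ hSω hT hbB hbA hdA hdB hRA
    hRB hwer hfl hins hbud hOp hroom hHist hBi hmass
  subst hSω
  exact ne5_of_record_restrict_gaussianParamBi_mass S₀ M hMA hMB E₀ cB α hT hbB hbA hdA hdB hRA hRB hwer hfl hins hbud hOp hroom hHist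
    hBi hmass hE₀ one_pos hG hcA hcB hc₁ hr₀ hδ' hθ0.le hθθ' hθ'1 hω hω1 hρ₀ hnear hB hfirst (smallness_of_gain hs)

end Uniform

/-! ## §3 Windowwise (R24 × R29′): g-INDEXED (2.14) dictionary on singleton windows, the SAME constant -/

section Windowwise

/-- [folklore] **THE (2.14)-FACE OF RECORD READ WINDOWWISE WITH A g-INDEXED DICTIONARY — ONE η-∕g-UNIFORM CONSTANT.**  §2 with every
window-dependent binder supplied at the singleton window `{g}` for each `g ∈ W` and the (2.14) dictionary g-INDEXED (`lam g, w g, N g, F₀ g,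
Λ g, q g, m g, b g, w₀ g, N₀ g, F g, N₁ g` — where the small-field thresholds `p(g)` of χ may live, owner R24 —, mass weights `a g`, COMMON
budget `G`): `NE5 (B13StepOfRecord.outA S₀ E₀ cB) (B13StepOfRecord.outB S₀ E₀ cB) W κ θ′ C₅` with the SAME `C₅` for every pair of runs, slot
package, sub-slot, window and coupling (`OutputRateWindow.ne5_of_forall_singleton`; R29′ (a): `∃ C₅` OUTERMOST).  NOT a proof of NE5. -/
theorem uniform_ne5_of_record_restrict_gaussianParamBi_mass_singleton {κ G EA₀ E₀ cA cB c₁ r₀ δ' θ θ' ω : ℝ}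
    (hE₀ : 0 ≤ E₀) (hG : 0 ≤ G) (hcA : 0 ≤ cA) (hcB : 0 ≤ cB) (hc₁ : 0 ≤ c₁) (hr₀ : 0 < r₀) (hδ' : 0 ≤ δ')
    (hθ0 : 0 < θ) (hθ1 : θ < 1) (hθθ' : θ ≤ θ') (hθ'1 : θ' ≤ 1) (hω : 0 < ω) (hω1 : ω < 1)
    (hh : cA * (EA₀ + E₀) < 1 - ω) (hsmall : ω + G * cA * (1 - ω) / (1 - ω - cA * (EA₀ + E₀)) < θ') :
    ∃ C₅ : ℝ, ∀ {𝔾 : Type} [GaugeGroup 𝔾] {R : TwoRuns 𝔾} {E IOp Hist : Type*} [NormedAddCommGroup Hist] [NormedSpace ℂ Hist]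
      (S₀ : Slots R E IOp Hist) (M : Submodule ℂ (OpDatum E))
      (hMA : ∀ g V k, opOf S₀.F S₀.rawA g V k ∈ M) (hMB : ∀ g U k, opOf S₀.F S₀.rawB g U k ∈ M)
      {β : ℕ → TermIdx R.carriers.Dom (Bnd R) → Type*} [∀ k i, MeasurableSpace (β k i)]
      (α : ℕ → TermIdx R.carriers.Dom (Bnd R) → Type*) [∀ k i, NormedAddCommGroup (α k i)] [∀ k i, InnerProductSpace ℝ (α k i)]
      [∀ k i, FiniteDimensional ℝ (α k i)] [∀ k i, MeasurableSpace (α k i)] [∀ k i, BorelSpace (α k i)]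
      {W : Set (ℕ → ℝ)} {ROp RHist R' : ℕ → ℝ} {a : (ℕ → ℝ) → ℕ → TermIdx R.carriers.Dom (Bnd R) → R.carriers.Dom → ℝ}
      {lam : (ℕ → ℝ) → ∀ k i, R.carriers.Dom → Measure (β k i)} {w : (ℕ → ℝ) → ∀ k i, R.carriers.Dom → β k i → ℂ}
      {N : (ℕ → ℝ) → ∀ k i, R.carriers.Dom → M → β k i → ℂ} {F₀ : (ℕ → ℝ) → ∀ k i, R.carriers.Dom → β k i → α k i → ℂ}
      {Λ : (ℕ → ℝ) → ∀ k i, R.carriers.Dom → β k i → α k i → (Hist →L[ℂ] ℂ)}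
      {q : (ℕ → ℝ) → ∀ k i, R.carriers.Dom → M → β k i → α k i → ℂ}
      {m b w₀ N₀ F N₁ : (ℕ → ℝ) → ℕ → TermIdx R.carriers.Dom (Bnd R) → R.carriers.Dom → ℝ},
      S₀.D.ω = ω →
      (∀ g ∈ W, (assembly S₀).TransportReads {g}) →
      (∀ g ∈ W, (assembly S₀).SliceBudgetB {g} κ cB) → (∀ g ∈ W, S₀.D.SliceBudget (step S₀ E₀ cB) {g} κ cA) →
      (∀ g ∈ W, DecayBound (B13StepOfRecord.outA S₀ E₀ cB) {g} EA₀ κ) →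
      (∀ g ∈ W, DecayBound (B13StepOfRecord.outB S₀ E₀ cB) {g} E₀ κ) →
      (∀ g ∈ W, RawBounded S₀.F (assembly S₀).rawAt {g}) → (∀ g ∈ W, RawBounded S₀.F S₀.rawB {g}) →
      (∀ g ∈ W, WeightedEntrywiseRate S₀.F (assembly S₀).rawAt S₀.rawB {g} c₁ (fun k => θ ^ k)) → (∀ k, r₀ ≤ S₀.rOp k) →
      (∀ g ∈ W, (step S₀ E₀ cB).InsertionRate {g} κ E₀ δ' θ) →
      (∀ g ∈ W, TermBudgetLoc (a g) G) → (∀ k, S₀.rOp k ≤ ROp k) → (∀ k, ROp k < R' k) →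
      (∀ k, (assembly S₀).bHist E₀ cB k + S₀.rHist k ≤ RHist k) →
      (∀ g ∈ W, TermGaussianParamBi (term (assemblyOn (restrict S₀ M hMA hMB)).𝒯 (assemblyOn (restrict S₀ M hMA hMB)).inc
        (restrict S₀ M hMA hMB).act) {g} (selfCtr (assemblyOn (restrict S₀ M hMA hMB)).raw (assemblyOn (restrict S₀ M hMA hMB)).histRef)
        RHist R' (lam g) (w g) (N g) (F₀ g) (Λ g) (q g) (m g) (b g) (w₀ g) (N₀ g) (F g) (N₁ g)) →
      (∀ g ∈ W, ∀ k, ∀ g' ∈ ({g} : Set (ℕ → ℝ)), ∀ (U : R.carriers.BgB), ∀ h ∈ closedBall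
        (selfCtr (assemblyOn (restrict S₀ M hMA hMB)).raw (assemblyOn (restrict S₀ M hMA hMB)).histRef k g' U).2 (RHist k),
        ∀ X : R.carriers.Dom, R.carriers.scale X = k → ∀ i,
        paramMass α (fun k i (_ : Hist) X => lam g k i X) (fun k i (_ : Hist) X => m g k i X) (fun k i (_ : Hist) X => b g k i X)
          (fun k i (_ : Hist) X => w₀ g k i X) (fun k i (_ : Hist) X => N₀ g k i X)
          (fun k i h X => F g k i X * Real.exp (N₁ g k i X * ‖h‖)) k i h X ≤ a g k i X * Real.exp (-(κ * R.carriers.d X))) →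
      NE5 (B13StepOfRecord.outA S₀ E₀ cB) (B13StepOfRecord.outB S₀ E₀ cB) W κ θ' C₅ := by
  obtain ⟨C₅, h⟩ := uniform_ne5_of_record_restrict_gaussianParamBi_mass (κ := κ) hE₀ hG hcA hcB hc₁ hr₀ hδ' hθ0 hθ1 hθθ' hθ'1 hω
    hω1 hh hsmall
  refine ⟨C₅, ?_⟩
  intro 𝔾 _ R E IOp Hist _ _ S₀ M hMA hMB β _ α _ _ _ _ _ W ROp RHist R' a lam w N F₀ Λ q m b w₀ N₀ F N₁ hSω hT hbB hbA hdA hdB hRA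
    hRB hwer hfl hins hbud hOp hroom hHist hBi hmass
  exact ne5_of_forall_singleton fun g hg =>
    h S₀ M hMA hMB α hSω (hT g hg) (hbB g hg) (hbA g hg) (hdA g hg) (hdB g hg) (hRA g hg) (hRB g hg) (hwer g hg) hfl (hins g hg)
      (hbud g hg) hOp hroom hHist (hBi g hg) (hmass g hg)

end Windowwise

end Summit.QuantumFields.BalabanUV.T4Continuum.B13StepEndLocArithmetic

end
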